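import Mathlib.InformationTheory.KullbackLeibler.Basic
import Mathlib.MeasureTheory.Integral.Prod
import Mathlib.Analysis.Convex.Integral
import HarnessLib

/-!
# The Donsker–Varadhan upper bound for the Kullback–Leibler divergence (bounded test functions)

Topic `Literature/Probability/Divergences`; companion of `FDivVariational.lean`, which proves the EASY half
`∫ g dμ ≤ KL(μ‖ν) + ∫ (e^g - 1) dν` (hence `∫ g dμ - log ∫ e^g dν ≤ KL(μ‖ν)`) of the variational formula for
Mathlib's `InformationTheory.klDiv`. This file proves the HARD half for probability measures, in the form used
to CONTROL a divergence by exponential moments (entropy budgets in the relative entropy method, Kipnis–Landim 1999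
Ch. 6 and Appendix 1 §8; originally Donsker–Varadhan 1975):

* `klDiv_le_of_forall_integral_le` — if `μ, ν` are probability measures and `∫ ψ dμ ≤ K + log ∫ e^ψ dν` for
  every BOUNDED measurable `ψ`, then `klDiv μ ν ≤ ENNReal.ofReal K` (so in particular `μ ≪ ν` and the
  log-likelihood ratio is `μ`-integrable) [KipnisLandim1999, Appendix 1, Thm. 8.3: the supremum over bounded `f`
  of `⟨μ, f⟩ - log ⟨π, e^f⟩` is `∫ log (dμ/dπ) dμ` when `μ ≪ π` and `+∞` otherwise]. Kipnis–Landim work on a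
  countable state space and pass to the limit along finite sub-σ-algebras; the proof here is the direct
  truncation argument on a general measurable space: absolute continuity from the tests `M·𝟙_A`; then for the
  clamped density `q_M = max(e^{-M}, min(e^M, dμ/dν))` the test `ψ = log q_M` yields `∫ klFun(q_M) dν ≤ K`
  (pointwise `q_M log q_M ≤ (dμ/dν) log q_M`, and `log y ≤ y - 1`), and Fatou's lemma along `q_M → dμ/dν`
  gives `klDiv μ ν = ∫ klFun(dμ/dν) dν ≤ K` (`InformationTheory.klDiv_eq_lintegral_klFun_of_ac`).
* `klDiv_fst_prod_le_of_forall` — the CONDITIONAL (fibrewise) form: for a probability law `L` on `α × β` and a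
  probability measure `γ` on `β`, if `∫ g dL ≤ K` for every bounded measurable `g` with `∫ e^{g(x,·)} dγ = 1`
  for all `x`, then `klDiv L (L.fst.prod γ) ≤ ENNReal.ofReal K` (fibrewise log-partition function
  `Λ(x) = log ∫ e^{ψ(x,·)} dγ`, Jensen for `exp` under `L.fst`, Fubini).

Not here: the equality statement of the variational formula (combine with `FDivVariational`), unbounded test
functions, and the topological version with continuous bounded `ψ` (Dembo–Zeitouni, Donsker–Varadhan).
-/

noncomputable section

open _root_.MeasureTheory _root_.ProbabilityTheory _root_.InformationTheory Set Filter
open scoped ENNReal _root_.Topology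

namespace Literature.Probability.Divergences

/-! ## The Donsker–Varadhan upper bound by truncation -/

/-- **Donsker–Varadhan, hard direction, for bounded test functions.** If two probability measures
`μ, ν` satisfy `∫ ψ dμ ≤ K + log ∫ e^ψ dν` for every bounded measurable `ψ`, then `KL(μ ‖ ν) ≤ K`.
Proof: `μ ≪ ν` by testing `M·𝟙_A` on `ν`-null sets; then with `r = dμ/dν` and the clamped density
`q_M = max(e^{-M}, min(e^M, r))`, the test function `ψ = log q_M` gives, since `q_M log q_M ≤ r log q_M`
pointwise and `log y ≤ y - 1`, `∫ klFun(q_M) dν ≤ K`; Fatou's lemma (`q_M → r`) and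
`KL = ∫ klFun(r) dν` conclude. This is the upper-bound half of Kipnis–Landim's Theorem A1.8.3
(`sup_f {⟨μ,f⟩ - log⟨π,e^f⟩}` over bounded `f` equals `∫ log(dμ/dπ) dμ` if `μ ≪ π` and `∞` otherwise),
stated there on a countable space and proved here on a general measurable space.
[cite: KipnisLandim1999, Appendix 1 Thm. 8.3 (p. 338)] -/
theorem klDiv_le_of_forall_integral_le {α : Type*} [MeasurableSpace α] {μ ν : Measure α}
    [IsProbabilityMeasure μ] [IsProbabilityMeasure ν] {K : ℝ}
    (h : ∀ (ψ : α → ℝ) (C : ℝ), Measurable ψ → (∀ x, |ψ x| ≤ C) →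
      ∫ x, ψ x ∂μ ≤ K + Real.log (∫ x, Real.exp (ψ x) ∂ν)) :
    klDiv μ ν ≤ ENNReal.ofReal K := by
  -- (a) absolute continuity: test `M • 𝟙_A` on a `ν`-null set `A`
  have hac : μ ≪ ν := by
    refine Measure.AbsolutelyContinuous.mk fun A hA hνA => ?_
    by_contra hμA
    have hm : 0 < μ.real A := by
      rw [measureReal_def]
      exact ENNReal.toReal_pos hμA (measure_ne_top μ A)
    have h1 := h (A.indicator fun _ => (K + 1) / μ.real A) |(K + 1) / μ.real A|
      (measurable_const.indicator hA) (fun x => by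
        rw [← Real.norm_eq_abs, ← Real.norm_eq_abs]
        exact norm_indicator_le_norm_self _ _)
    have hI : ∫ x, A.indicator (fun _ => (K + 1) / μ.real A) x ∂μ = K + 1 := by
      rw [integral_indicator_const _ hA, smul_eq_mul, ← mul_div_assoc, mul_div_cancel_left₀ _ hm.ne']
    have hE : ∫ x, Real.exp (A.indicator (fun _ => (K + 1) / μ.real A) x) ∂ν = 1 := by
      have hae : (fun x => Real.exp (A.indicator (fun _ => (K + 1) / μ.real A) x)) =ᵐ[ν]
          fun _ => 1 := by
        filter_upwards [measure_eq_zero_iff_ae_notMem.1 hνA] with x hx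
        rw [indicator_of_notMem hx, Real.exp_zero]
      rw [integral_congr_ae hae, integral_const, smul_eq_mul, mul_one, probReal_univ]
    rw [hI, hE, Real.log_one, add_zero] at h1
    linarith
  -- (b) truncation: `q_M = clamp (dμ/dν) [e^{-M}, e^M]`, `ψ_M = log q_M`
  rw [klDiv_eq_lintegral_klFun_of_ac hac]
  set r := μ.rnDeriv ν with hr
  have hrm : Measurable fun x => (r x).toReal := (Measure.measurable_rnDeriv μ ν).ennreal_toReal
  set q : ℕ → α → ℝ := fun M x => max (Real.exp (-M)) (min (Real.exp M) (r x).toReal) with hq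
  have hq_pos : ∀ (M : ℕ) x, 0 < q M x := fun M x => (Real.exp_pos _).trans_le (le_max_left _ _)
  have hge : ∀ (M : ℕ) x, Real.exp (-(M : ℝ)) ≤ q M x := fun M x => le_max_left _ _
  have hq_le : ∀ (M : ℕ) x, q M x ≤ Real.exp M := fun M x =>
    max_le (Real.exp_le_exp.2 (by linarith [(M.cast_nonneg : (0 : ℝ) ≤ M)])) (min_le_left _ _)
  have hqm : ∀ M, Measurable (q M) := fun M => measurable_const.max (measurable_const.min hrm)
  have hkey : ∀ M : ℕ, ∫⁻ x, ENNReal.ofReal (klFun (q M x)) ∂ν ≤ ENNReal.ofReal K := by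
    intro M
    have hψm : Measurable fun x => Real.log (q M x) := Real.measurable_log.comp (hqm M)
    have hψb : ∀ x, |Real.log (q M x)| ≤ M := by
      intro x
      rw [abs_le]
      refine ⟨?_, ?_⟩
      · rw [← Real.log_exp (-(M : ℝ))]
        exact Real.log_le_log (Real.exp_pos _) (hge M x)
      · rw [← Real.log_exp (M : ℝ)]
        exact Real.log_le_log (hq_pos M x) (hq_le M x)
    have h1 := h _ _ hψm hψb
    have hexplog : ∀ x, Real.exp (Real.log (q M x)) = q M x := fun x => Real.exp_log (hq_pos M x)
    simp_rw [hexplog] at h1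
    rw [← integral_toReal_rnDeriv_mul hac] at h1
    have hqi : Integrable (q M) ν :=
      Integrable.of_bound (hqm M).aestronglyMeasurable (Real.exp M) (ae_of_all _ fun x => by
        rw [Real.norm_eq_abs, abs_of_pos (hq_pos M x)]
        exact hq_le M x)
    have hqlogi : Integrable (fun x => q M x * Real.log (q M x)) ν :=
      Integrable.of_bound ((hqm M).mul hψm).aestronglyMeasurable (Real.exp M * M)
        (ae_of_all _ fun x => by
          rw [Real.norm_eq_abs, abs_mul, abs_of_pos (hq_pos M x)]
          exact mul_le_mul (hq_le M x) (hψb x) (abs_nonneg _) (Real.exp_pos _).le)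
    have hrlogi : Integrable (fun x => (r x).toReal * Real.log (q M x)) ν :=
      (integrable_toReal_rnDeriv_mul_iff hac).2 (Integrable.of_bound hψm.aestronglyMeasurable M
        (ae_of_all _ fun x => by rw [Real.norm_eq_abs]; exact hψb x))
    -- pointwise `q log q ≤ r log q`
    have hpt : ∀ x, q M x * Real.log (q M x) ≤ (r x).toReal * Real.log (q M x) := by
      intro x
      have heM : Real.exp (-(M : ℝ)) ≤ Real.exp M :=
        Real.exp_le_exp.2 (by linarith [(M.cast_nonneg : (0 : ℝ) ≤ M)])
      rcases le_total (r x).toReal (Real.exp (-(M : ℝ))) with hlo | hlo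
      · have hqx : q M x = Real.exp (-(M : ℝ)) := by
          simp only [hq]
          rw [min_eq_right (hlo.trans heM), max_eq_left hlo]
        rw [hqx, Real.log_exp]
        exact mul_le_mul_of_nonpos_right hlo (by linarith [(M.cast_nonneg : (0 : ℝ) ≤ M)])
      · rcases le_total (r x).toReal (Real.exp M) with hhi | hhi
        · have hqx : q M x = (r x).toReal := by
            simp only [hq]
            rw [min_eq_right hhi, max_eq_right hlo]
          rw [hqx]
        · have hqx : q M x = Real.exp M := by
            simp only [hq]
            rw [min_eq_left hhi, max_eq_right heM]
          rw [hqx, Real.log_exp]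
          exact mul_le_mul_of_nonneg_right hhi M.cast_nonneg
    have hklFun_eq : (fun x => klFun (q M x)) = fun x => q M x * Real.log (q M x) + (1 - q M x) := by
      funext x
      rw [klFun_apply]
      ring
    have hklFun_int : Integrable (fun x => klFun (q M x)) ν := by
      rw [hklFun_eq]
      exact hqlogi.add ((integrable_const 1).sub hqi)
    have hI0 : 0 < ∫ x, q M x ∂ν := by
      refine lt_of_lt_of_le (Real.exp_pos (-(M : ℝ))) ?_
      have := integral_mono (integrable_const (Real.exp (-(M : ℝ)))) hqi (fun x => hge M x)
      rwa [integral_const, smul_eq_mul, probReal_univ, one_mul] at this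
    have hmain : ∫ x, klFun (q M x) ∂ν ≤ K := by
      have hsplit : ∫ x, klFun (q M x) ∂ν =
          ∫ x, q M x * Real.log (q M x) ∂ν + (1 - ∫ x, q M x ∂ν) := by
        have h1q : Integrable (fun x => 1 - q M x) ν := (integrable_const 1).sub hqi
        rw [hklFun_eq, integral_add hqlogi h1q, integral_sub (integrable_const 1) hqi, integral_const,
          smul_eq_mul, probReal_univ, one_mul]
      have hmono := integral_mono hqlogi hrlogi hpt
      have hlog : Real.log (∫ x, q M x ∂ν) ≤ ∫ x, q M x ∂ν - 1 := Real.log_le_sub_one_of_pos hI0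
      linarith
    calc ∫⁻ x, ENNReal.ofReal (klFun (q M x)) ∂ν = ENNReal.ofReal (∫ x, klFun (q M x) ∂ν) :=
          (ofReal_integral_eq_lintegral_ofReal hklFun_int
            (ae_of_all _ fun x => klFun_nonneg (hq_pos M x).le)).symm
      _ ≤ ENNReal.ofReal K := ENNReal.ofReal_le_ofReal hmain
  -- (c) Fatou along `M → ∞`
  have hlim : ∀ x, Tendsto (fun M : ℕ => ENNReal.ofReal (klFun (q M x))) atTop
      (𝓝 (ENNReal.ofReal (klFun (r x).toReal))) := by
    intro x
    refine ENNReal.tendsto_ofReal ((continuous_klFun.tendsto _).comp ?_)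
    have h1 : Tendsto (fun M : ℕ => Real.exp (-(M : ℝ))) atTop (𝓝 0) :=
      Real.tendsto_exp_neg_atTop_nhds_zero.comp tendsto_natCast_atTop_atTop
    have h2 : Tendsto (fun M : ℕ => min (Real.exp M) (r x).toReal) atTop (𝓝 (r x).toReal) := by
      refine tendsto_const_nhds.congr' ?_
      filter_upwards [Filter.eventually_ge_atTop ⌈(r x).toReal⌉₊] with M hM
      have : (r x).toReal ≤ Real.exp M :=
        calc (r x).toReal ≤ ⌈(r x).toReal⌉₊ := Nat.le_ceil _
          _ ≤ (M : ℝ) := by exact_mod_cast hM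
          _ ≤ Real.exp M := by linarith [Real.add_one_le_exp (M : ℝ)]
      exact (min_eq_right this).symm
    have h3 := h1.max h2
    rwa [max_eq_right ENNReal.toReal_nonneg] at h3
  calc ∫⁻ x, ENNReal.ofReal (klFun (r x).toReal) ∂ν
      = ∫⁻ x, liminf (fun M : ℕ => ENNReal.ofReal (klFun (q M x))) atTop ∂ν :=
        lintegral_congr fun x => ((hlim x).liminf_eq).symm
    _ ≤ liminf (fun M : ℕ => ∫⁻ x, ENNReal.ofReal (klFun (q M x)) ∂ν) atTop :=
        lintegral_liminf_le fun M => (measurable_klFun.comp (hqm M)).ennreal_ofReal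
    _ ≤ ENNReal.ofReal K := liminf_le_of_frequently_le' (Frequently.of_forall hkey)

/-- **Conditional Donsker–Varadhan bound.** For a probability law `L` on `α × β` and a probability
measure `γ` on `β`: if `∫ g dL ≤ K` for every bounded measurable `g` that is fibrewise normalised,
`∫ e^{g(x,·)} dγ = 1` for all `x`, then `KL(L ‖ L₁ ⊗ γ) ≤ K` (`L₁ = L.fst`). Reduction to
`klDiv_le_of_forall_integral_le`: for bounded measurable `ψ` put `Λ(x) = log ∫ e^{ψ(x,·)} dγ` and
`g = ψ - Λ ∘ fst`; then `∫ ψ dL = ∫ g dL + ∫ Λ dL₁ ≤ K + log ∫ e^Λ dL₁ = K + log ∫ e^ψ d(L₁ ⊗ γ)`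
(Jensen for `exp`, Fubini). [folklore] -/
theorem klDiv_fst_prod_le_of_forall {α β : Type*} [MeasurableSpace α] [MeasurableSpace β]
    {L : Measure (α × β)} [IsProbabilityMeasure L] {γ : Measure β} [IsProbabilityMeasure γ] {K : ℝ}
    (h : ∀ (g : α × β → ℝ) (C : ℝ), Measurable g → (∀ p, |g p| ≤ C) →
      (∀ x, ∫ v, Real.exp (g (x, v)) ∂γ = 1) → ∫ p, g p ∂L ≤ K) :
    klDiv L (L.fst.prod γ) ≤ ENNReal.ofReal K := by
  refine klDiv_le_of_forall_integral_le fun ψ C hψm hψC => ?_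
  have hem : Measurable fun p : α × β => Real.exp (ψ p) := Real.measurable_exp.comp hψm
  have heb : ∀ p, Real.exp (-C) ≤ Real.exp (ψ p) ∧ Real.exp (ψ p) ≤ Real.exp C := fun p =>
    ⟨Real.exp_le_exp.2 ((neg_le_neg (hψC p)).trans (neg_abs_le _)),
      Real.exp_le_exp.2 ((le_abs_self _).trans (hψC p))⟩
  have hexpi : ∀ x, Integrable (fun v => Real.exp (ψ (x, v))) γ := fun x =>
    Integrable.of_bound (hem.comp measurable_prodMk_left).aestronglyMeasurable (Real.exp C)
      (ae_of_all _ fun v => by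
        rw [Real.norm_eq_abs, abs_of_pos (Real.exp_pos _)]
        exact (heb (x, v)).2)
  have hIlo : ∀ x, Real.exp (-C) ≤ ∫ v, Real.exp (ψ (x, v)) ∂γ := fun x => by
    have := integral_mono (integrable_const (Real.exp (-C))) (hexpi x) (fun v => (heb (x, v)).1)
    rwa [integral_const, smul_eq_mul, probReal_univ, one_mul] at this
  have hIhi : ∀ x, ∫ v, Real.exp (ψ (x, v)) ∂γ ≤ Real.exp C := fun x => by
    have := integral_mono (hexpi x) (integrable_const (Real.exp C)) (fun v => (heb (x, v)).2)
    rwa [integral_const, smul_eq_mul, probReal_univ, one_mul] at this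
  have hIpos : ∀ x, 0 < ∫ v, Real.exp (ψ (x, v)) ∂γ := fun x => (Real.exp_pos _).trans_le (hIlo x)
  -- the fibrewise log-partition function `Λ`
  set Λ : α → ℝ := fun x => Real.log (∫ v, Real.exp (ψ (x, v)) ∂γ) with hΛ
  have hΛm : Measurable Λ :=
    Real.measurable_log.comp (hem.stronglyMeasurable.integral_prod_right' (ν := γ)).measurable
  have hΛb : ∀ x, |Λ x| ≤ C := fun x => abs_le.2
    ⟨by rw [← Real.log_exp (-C)]; exact Real.log_le_log (Real.exp_pos _) (hIlo x),
      by rw [← Real.log_exp C]; exact Real.log_le_log (hIpos x) (hIhi x)⟩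
  -- test function `g = ψ - Λ ∘ fst`, normalised on every fibre
  have hg := h (fun p => ψ p - Λ p.1) (C + C) (hψm.sub (hΛm.comp measurable_fst))
    (fun p => (abs_sub _ _).trans (add_le_add (hψC p) (hΛb p.1))) (fun x => by
      simp only [Real.exp_sub]
      rw [integral_div, Real.exp_log (hIpos x), div_self (hIpos x).ne'])
  have hψi : Integrable ψ L := Integrable.of_bound hψm.aestronglyMeasurable C
    (ae_of_all _ fun p => by rw [Real.norm_eq_abs]; exact hψC p)
  have hΛi : Integrable (fun p : α × β => Λ p.1) L :=
    Integrable.of_bound (hΛm.comp measurable_fst).aestronglyMeasurable C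
      (ae_of_all _ fun p => by rw [Real.norm_eq_abs]; exact hΛb p.1)
  have hsub : ∫ p, ψ p - Λ p.1 ∂L = ∫ p, ψ p ∂L - ∫ p, Λ p.1 ∂L := integral_sub hψi hΛi
  have hfst : ∫ p, Λ p.1 ∂L = ∫ x, Λ x ∂L.fst := by
    rw [Measure.fst, integral_map measurable_fst.aemeasurable hΛm.aestronglyMeasurable]
  -- Jensen: `∫ Λ dL₁ ≤ log ∫ e^Λ dL₁ = log ∫ e^ψ d(L₁ ⊗ γ)`
  have hΛi' : Integrable Λ L.fst := Integrable.of_bound hΛm.aestronglyMeasurable C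
    (ae_of_all _ fun x => by rw [Real.norm_eq_abs]; exact hΛb x)
  have heΛi : Integrable (fun x => Real.exp (Λ x)) L.fst :=
    Integrable.of_bound (Real.measurable_exp.comp hΛm).aestronglyMeasurable (Real.exp C)
      (ae_of_all _ fun x => by
        rw [Real.norm_eq_abs, abs_of_pos (Real.exp_pos _)]
        exact Real.exp_le_exp.2 ((le_abs_self _).trans (hΛb x)))
  have hJ := ConvexOn.map_integral_le convexOn_exp Real.continuous_exp.continuousOn isClosed_univ
    (ae_of_all _ fun x => mem_univ (Λ x)) hΛi' heΛi
  have hJ' : ∫ x, Λ x ∂L.fst ≤ Real.log (∫ x, Real.exp (Λ x) ∂L.fst) := by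
    rw [← Real.log_exp (∫ x, Λ x ∂L.fst)]
    exact Real.log_le_log (Real.exp_pos _) hJ
  have hprod : ∫ p, Real.exp (ψ p) ∂(L.fst.prod γ) = ∫ x, Real.exp (Λ x) ∂L.fst := by
    have hint : Integrable (fun p : α × β => Real.exp (ψ p)) (L.fst.prod γ) :=
      Integrable.of_bound hem.aestronglyMeasurable (Real.exp C) (ae_of_all _ fun p => by
        rw [Real.norm_eq_abs, abs_of_pos (Real.exp_pos _)]
        exact (heb p).2)
    rw [integral_prod _ hint]
    refine integral_congr_ae (ae_of_all _ fun x => ?_)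
    simp only [hΛ]
    rw [Real.exp_log (hIpos x)]
  rw [hprod]
  linarith

end Literature.Probability.Divergences

end
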